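import Literature.Analysis.FluidPDE.MillerMiddleEigenvalueTorus
import HarnessLib

/-!
# Functional mining, no-go side: two pointwise linear-algebra facts for the K1-Q2 (q = 2m ≥ 4) kill-all search

Search for candidate a priori estimates; no regularity claim.

NS FUNCTIONAL MINING cell (`pub-nsfunc`), no-go seat, NOGO.md §1 N11. The dict seat's door
(`MiddleEigenDoor.lean`, staged) reduces the K1-Q2 row `MiddleEigenvalueMomentRateBound (2m) C` to a
static inequality, refuted for EVERY `C` by one smooth divergence-free field on `T³` whose middle
strain eigenvalue `λ₂(S(x))` (Mathlib's decreasing `eigenvalues₀`, index `1` of `3`) is `≤ 0`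
everywhere while `∫|ω|^{2(m−1)}σ > 0`; for a FIXED `C` it suffices to exhibit a field with
`2m∫|ω|^{2(m−1)}σ > C·Λ·∫|ω|^{2m}` for some `Λ ≥ max_x λ₂`. This file supplies, over any index type
of cardinality `3`:

* `MiddleEigen.middle_le_sqrt_sumSq_div_six` — for a real symmetric trace-free matrix `M`,
  `λ₂(M) ≤ √(Σᵢⱼ Mᵢⱼ² / 6)` (sharp: equality at `diag(a, a, −2a)`). So a certified upper bound of
  `sup_x |S(x)|_F` (an `ℓ¹`-Fourier bound for trigonometric fields — pure arithmetic) yields an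
  admissible `Λ = sup|S|_F/√6` for fixed-`C` certificates without any eigenvalue computation
  (NOGO N11(e));
* `MiddleEigen.det_nonneg_of_middle_nonpos` — `λ₂ ≤ 0 ⇒ 0 ≤ det M` (symmetric, trace-free,
  `3` indices; the dict seat's staged `det_nonneg_iff_middleEigenvalue_nonpos` has both directions —
  re-proved here in the direction used below so that this file depends on tree modules only);
* `MiddleEigen.eq_smul_axisDiag_of_commute_quarterTurn` — the ALGEBRAIC CORE of the axis lemma
  N11(b): a real symmetric trace-free `3 × 3` matrix commuting with the quarter turn about `e₂`,
  `R = !![0,-1,0; 1,0,0; 0,0,1]`, equals `M₂₂ · diag(−½, −½, 1)`; hence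
  `MiddleEigen.det_neg_of_commute_quarterTurn` (`M₂₂ < 0 ⇒ det M < 0`) and
  `MiddleEigen.middle_pos_of_commute_quarterTurn` (`M₂₂ < 0 ⇒ λ₂(M) > 0`). Along a closed vertical
  axis of 4-fold symmetry of a periodic divergence-free field the strain is such a matrix with
  `M₂₂ = ∂_z v_z`, whose axial mean is `0`; so a strained 4-fold-symmetric vortex axis always carries
  points with `λ₂ > 0` (N11(b), whose torus/equivariance wrapper — "∇v commutes with R on the axis"
  — stays at paper level here). In particular the periodised-Burgers seed
  `A(−sin x cos z, −sin y cos z, (cos x + cos y) sin z)` (+ any axisymmetric tube on `x = y = 0`)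
  violates `λ₂ ≤ 0` on half of its axis.

* `MiddleEigen.middle_eq_zero_of_det_eq_zero`, `MiddleEigen.shear_structural_zero`,
  `MiddleEigen.middle_shearStrain_eq_zero` — unidirectional shears `(f(z), g(z), 0)` have `λ₂ ≡ 0` and
  `ωᵀSω ≡ 0` (zeroth order of N11(f); the second-order statement at the Beltrami shear stays at paper
  level).

All statements are finite-dimensional linear algebra [folklore]; nothing is claimed about
Navier–Stokes.

## References

* E. Miller, Arch. Ration. Mech. Anal. 235 (2020) 99–139 = arXiv:1710.05569, Lemma 5.1 (the
  eigenvalue bookkeeping `λ₁ ≥ λ₂ ≥ λ₃`, `Σλ = 0` reused here; tree file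
  `MillerMiddleEigenvalueTorus`). [Miller2019]
-/

noncomputable section

open Finset Matrix

namespace Summit.NavierStokesRegularity.FunctionalMining

namespace MiddleEigen

/-! ### Real bookkeeping for three sorted reals with zero sum -/

/-- `a ≥ b ≥ c`, `a + b + c = 0`, `b ≥ 0` ⇒ `6b² ≤ a² + b² + c²`. [folklore] -/
theorem six_mul_middle_sq_le {a b c : ℝ} (hab : b ≤ a) (hbc : c ≤ b) (hsum : a + b + c = 0)
    (hb : 0 ≤ b) : 6 * b ^ 2 ≤ a ^ 2 + b ^ 2 + c ^ 2 := by
  have hc : c = -a - b := by linarith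
  subst hc
  nlinarith [mul_nonneg hb (sub_nonneg.mpr hab)]

/-- `a ≥ b ≥ c`, `a + b + c = 0`, `b ≤ 0` ⇒ `0 ≤ abc`. [folklore] -/
theorem prod_nonneg_of_middle_nonpos {a b c : ℝ} (hab : b ≤ a) (hbc : c ≤ b)
    (hsum : a + b + c = 0) (hb : b ≤ 0) : 0 ≤ a * b * c := by
  have ha : 0 ≤ a := by linarith
  have hc : c ≤ 0 := le_trans hbc hb
  have : 0 ≤ b * c := mul_nonneg_of_nonpos_of_nonpos hb hc
  rw [mul_assoc]
  exact mul_nonneg ha this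

/-! ### The sorted eigenvalues of a symmetric trace-free matrix over three indices -/

variable {n : Type*} [Fintype n] [DecidableEq n]

/-- Spectral bookkeeping (Miller-file template): for a real symmetric trace-free `M` over an index
type of cardinality `3`, with `lam a := eigenvalues₀ (Fin.cast _ a)`:
`det M = lam 0 · lam 1 · lam 2`, `lam 0 + lam 1 + lam 2 = 0`, `Σᵢⱼ Mᵢⱼ² = Σ lam²`,
`lam 1 ≤ lam 0`, `lam 2 ≤ lam 1`. [folklore] -/
theorem spectral_bookkeeping (hn : Fintype.card n = 3) (M : Matrix n n ℝ) (hsym : M.IsSymm)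
    (htr : M.trace = 0) :
    let hH : M.IsHermitian := Matrix.isHermitian_iff_isSymm.mpr hsym
    let lam : Fin 3 → ℝ := fun a => hH.eigenvalues₀ (Fin.cast hn.symm a)
    M.det = lam 0 * lam 1 * lam 2 ∧ lam 0 + lam 1 + lam 2 = 0 ∧
      (∑ i, ∑ j, M i j ^ 2) = lam 0 ^ 2 + lam 1 ^ 2 + lam 2 ^ 2 ∧
      lam 1 ≤ lam 0 ∧ lam 2 ≤ lam 1 := by
  intro hH lam
  have hE : ∀ f : ℝ → ℝ, ∑ i, f (hH.eigenvalues i) = ∑ a : Fin 3, f (lam a) := by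
    intro f
    have h1 : ∑ i, f (hH.eigenvalues i) = ∑ k, f (hH.eigenvalues₀ k) :=
      Fintype.sum_equiv (Fintype.equivOfCardEq (Fintype.card_fin _)).symm _ _ (fun i => rfl)
    rw [h1]
    exact Fintype.sum_equiv (finCongr hn) _ _ (fun k => by simp [lam, finCongr])
  have hP : ∏ i, hH.eigenvalues i = ∏ a : Fin 3, lam a := by
    have h1 : ∏ i, hH.eigenvalues i = ∏ k, hH.eigenvalues₀ k :=
      Fintype.prod_equiv (Fintype.equivOfCardEq (Fintype.card_fin _)).symm _ _ (fun i => rfl)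
    rw [h1]
    exact Fintype.prod_equiv (finCongr hn) _ _ (fun k => by simp [lam, finCongr])
  have hdet : M.det = ∏ a : Fin 3, lam a := by
    have := hH.det_eq_prod_eigenvalues
    simp only [RCLike.ofReal_real_eq_id, id_eq] at this
    rw [this, hP]
  have htr' : ∑ a : Fin 3, lam a = 0 := by
    have := hH.trace_eq_sum_eigenvalues
    simp only [RCLike.ofReal_real_eq_id, id_eq] at this
    rw [← hE (fun x => x), ← this, htr]
  have hfro : ∑ i, ∑ j, M i j ^ 2 = ∑ a : Fin 3, lam a ^ 2 := by
    rw [Literature.Geometry.Riemannian.GurskyLeBrun.sum_sq_eq_sum_eigenvalues_sq hsym]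
    exact hE (fun x => x ^ 2)
  have hanti : Antitone lam := fun a b hab =>
    hH.eigenvalues₀_antitone ((Fin.cast_le_cast hn.symm).mpr hab)
  simp only [Fin.sum_univ_three, Fin.prod_univ_three] at htr' hdet hfro
  exact ⟨hdet, htr', hfro, hanti (by decide), hanti (by decide)⟩

/-- **`λ₂ ≤ |M|_F/√6`** for a real symmetric trace-free matrix over three indices
(`λ₂ = eigenvalues₀ 1`; sharp at `diag(a, a, −2a)`). An eigenvalue-free admissible `Λ` for fixed-`C`
K1-Q2 certificates: `Λ = sup_x |S(x)|_F / √6`. [folklore] -/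
theorem middle_le_sqrt_sumSq_div_six (hn : Fintype.card n = 3) (M : Matrix n n ℝ)
    (hsym : M.IsSymm) (htr : M.trace = 0) :
    (Matrix.isHermitian_iff_isSymm.mpr hsym).eigenvalues₀ (Fin.cast hn.symm 1) ≤
      Real.sqrt ((∑ i, ∑ j, M i j ^ 2) / 6) := by
  obtain ⟨-, hsum, hfro, h10, h21⟩ := spectral_bookkeeping hn M hsym htr
  set hH : M.IsHermitian := Matrix.isHermitian_iff_isSymm.mpr hsym
  set b := hH.eigenvalues₀ (Fin.cast hn.symm 1) with hb
  rcases le_or_gt b 0 with hb0 | hb0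
  · exact hb0.trans (Real.sqrt_nonneg _)
  · have h6 := six_mul_middle_sq_le h10 h21 hsum hb0.le
    refine Real.le_sqrt_of_sq_le ?_
    rw [hfro]
    linarith

/-- **`λ₂ ≤ 0 ⇒ 0 ≤ det M`** (real symmetric trace-free, three indices): `det = λ₁λ₂λ₃` with
`λ₁ ≥ 0 ≥ λ₂ ≥ λ₃`. [folklore] -/
theorem det_nonneg_of_middle_nonpos (hn : Fintype.card n = 3) (M : Matrix n n ℝ)
    (hsym : M.IsSymm) (htr : M.trace = 0)
    (h : (Matrix.isHermitian_iff_isSymm.mpr hsym).eigenvalues₀ (Fin.cast hn.symm 1) ≤ 0) :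
    0 ≤ M.det := by
  obtain ⟨hdet, hsum, -, h10, h21⟩ := spectral_bookkeeping hn M hsym htr
  rw [hdet]
  exact prod_nonneg_of_middle_nonpos h10 h21 hsum h

/-- Contrapositive: **`det M < 0 ⇒ λ₂ > 0`**. [folklore] -/
theorem middle_pos_of_det_neg (hn : Fintype.card n = 3) (M : Matrix n n ℝ) (hsym : M.IsSymm)
    (htr : M.trace = 0) (h : M.det < 0) :
    0 < (Matrix.isHermitian_iff_isSymm.mpr hsym).eigenvalues₀ (Fin.cast hn.symm 1) := by
  by_contra hle
  exact absurd (det_nonneg_of_middle_nonpos hn M hsym htr (not_lt.mp hle)) (not_le.mpr h)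

/-! ### The algebraic core of the axis lemma (N11(b)): commuting with a quarter turn -/

/-- The quarter turn about the third axis, `R e₀ = e₁`, `R e₁ = −e₀`, `R e₂ = e₂`. [folklore] -/
def quarterTurn : Matrix (Fin 3) (Fin 3) ℝ := !![0, -1, 0; 1, 0, 0; 0, 0, 1]

/-- The axis form `diag(−½, −½, 1)`. [folklore] -/
def axisDiag : Matrix (Fin 3) (Fin 3) ℝ := !![-1/2, 0, 0; 0, -1/2, 0; 0, 0, 1]

/-- **A real symmetric trace-free `3 × 3` matrix commuting with the quarter turn about `e₂` is
`M₂₂ · diag(−½, −½, 1)`** (Schur: the rotation acts irreducibly on the transverse plane, so the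
transverse block is scalar and the mixed entries vanish; trace zero fixes the scalar). [folklore] -/
theorem eq_smul_axisDiag_of_commute_quarterTurn (M : Matrix (Fin 3) (Fin 3) ℝ) (hsym : M.IsSymm)
    (htr : M.trace = 0) (hR : M * quarterTurn = quarterTurn * M) :
    M = M 2 2 • axisDiag := by
  have h : ∀ i j, (M * quarterTurn) i j = (quarterTurn * M) i j := fun i j => by rw [hR]
  have hs : ∀ i j, M j i = M i j := fun i j => by
    simpa [Matrix.transpose_apply] using congrFun (congrFun hsym i) j
  simp only [Matrix.trace, Matrix.diag, Fin.sum_univ_three] at htr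
  have h00 := h 0 0; have h01 := h 0 1; have h02 := h 0 2; have h10 := h 1 0; have h11 := h 1 1
  have h12 := h 1 2; have h20 := h 2 0; have h21 := h 2 1; have h22 := h 2 2
  simp [quarterTurn, Matrix.mul_apply, Fin.sum_univ_three] at h00 h01 h02 h10 h11 h12 h20 h21 h22
  have s01 := hs 0 1; have s02 := hs 0 2; have s12 := hs 1 2
  ext i j
  fin_cases i <;> fin_cases j <;>
    simp [axisDiag, Matrix.smul_apply] <;> linarith

/-- `det (c • diag(−½, −½, 1)) = c³/4`. [folklore] -/
theorem det_smul_axisDiag (c : ℝ) : (c • axisDiag).det = c ^ 3 / 4 := by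
  have hA : axisDiag.det = 1 / 4 := by
    norm_num [axisDiag, Matrix.det_fin_three, Matrix.cons_val_zero, Matrix.cons_val_one,
      Matrix.cons_val_two, Matrix.head_cons, Matrix.tail_cons]
  rw [Matrix.det_smul, hA, Fintype.card_fin]
  ring

/-- **Axis lemma, algebraic core**: a real symmetric trace-free `3 × 3` matrix commuting with the
quarter turn about `e₂` and with NEGATIVE axial entry `M₂₂ < 0` has `det M < 0` … [folklore] -/
theorem det_neg_of_commute_quarterTurn (M : Matrix (Fin 3) (Fin 3) ℝ) (hsym : M.IsSymm)
    (htr : M.trace = 0) (hR : M * quarterTurn = quarterTurn * M) (hc : M 2 2 < 0) :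
    M.det < 0 := by
  rw [eq_smul_axisDiag_of_commute_quarterTurn M hsym htr hR, det_smul_axisDiag]
  set c := M 2 2
  have h2 : 0 < c * c := mul_pos_of_neg_of_neg hc hc
  have h3 : c ^ 3 = c * c * c := by ring
  rw [h3]
  have := mul_neg_of_pos_of_neg h2 hc
  linarith

/-- … **and therefore middle eigenvalue `λ₂(M) > 0`** (N11(b): on a strained 4-fold-symmetric closed
vortex axis, where `M₂₂ = ∂_z v_z` has zero mean, the constraint `λ₂ ≤ 0` of the K1-Q2 kill-all
certificate fails somewhere). [folklore] -/
theorem middle_pos_of_commute_quarterTurn (M : Matrix (Fin 3) (Fin 3) ℝ) (hsym : M.IsSymm)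
    (htr : M.trace = 0) (hR : M * quarterTurn = quarterTurn * M) (hc : M 2 2 < 0) :
    0 < (Matrix.isHermitian_iff_isSymm.mpr hsym).eigenvalues₀
      (Fin.cast (Fintype.card_fin 3).symm 1) :=
  middle_pos_of_det_neg (Fintype.card_fin 3) M hsym htr
    (det_neg_of_commute_quarterTurn M hsym htr hR hc)

/-- Worked instance (the periodised-Burgers seed on its axis at height `z` with `cos z < 0`,
normalised): `M = diag(1, 1, −2)` is symmetric, trace-free, commutes with the quarter turn, has
`M₂₂ = −2 < 0`, hence `det M = −2 < 0` and `λ₂(M) > 0`. [folklore] -/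
theorem burgersSeed_axis_example :
    let M : Matrix (Fin 3) (Fin 3) ℝ := !![1, 0, 0; 0, 1, 0; 0, 0, -2]
    M.det < 0 ∧ M * quarterTurn = quarterTurn * M := by
  refine ⟨?_, ?_⟩
  · norm_num [Matrix.det_fin_three, Matrix.cons_val_zero, Matrix.cons_val_one, Matrix.cons_val_two,
      Matrix.head_cons, Matrix.tail_cons]
  · ext i j
    fin_cases i <;> fin_cases j <;>
      simp [quarterTurn, Matrix.mul_apply, Fin.sum_univ_three]

/-! ### Unidirectional shears are structural zeros (N11(f), zeroth order) -/

/-- **`det M = 0 ⇒ λ₂(M) = 0`** for a real symmetric trace-free matrix over three indices: the sorted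
eigenvalues `λ₁ ≥ λ₂ ≥ λ₃` with `Σλ = 0`, `Πλ = 0` are `(μ, 0, −μ)`. [folklore] -/
theorem middle_eq_zero_of_det_eq_zero (hn : Fintype.card n = 3) (M : Matrix n n ℝ)
    (hsym : M.IsSymm) (htr : M.trace = 0) (hdet : M.det = 0) :
    (Matrix.isHermitian_iff_isSymm.mpr hsym).eigenvalues₀ (Fin.cast hn.symm 1) = 0 := by
  obtain ⟨hd, hsum, -, h10, h21⟩ := spectral_bookkeeping hn M hsym htr
  set hH : M.IsHermitian := Matrix.isHermitian_iff_isSymm.mpr hsym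
  set a := hH.eigenvalues₀ (Fin.cast hn.symm 0)
  set b := hH.eigenvalues₀ (Fin.cast hn.symm 1)
  set c := hH.eigenvalues₀ (Fin.cast hn.symm 2)
  rw [hdet] at hd
  -- a * b * c = 0 with a ≥ b ≥ c, a + b + c = 0
  rcases mul_eq_zero.mp hd.symm with hab | hc
  · rcases mul_eq_zero.mp hab with ha | hb
    · -- a = 0 ⇒ b ≤ 0 and c ≤ b, sum zero ⇒ b = 0
      have : b ≤ 0 := ha ▸ h10
      linarith
    · exact hb
  · have : 0 ≤ b := hc ▸ h21
    linarith

/-- The strain of a unidirectional shear `u = (f(z), g(z), 0)`: `S = ½(e_z ⊗ b + b ⊗ e_z)`,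
`b = (f′, g′, 0) = (b₁, b₂, 0)`. [folklore] -/
def shearStrain (b₁ b₂ : ℝ) : Matrix (Fin 3) (Fin 3) ℝ :=
  !![0, 0, b₁ / 2; 0, 0, b₂ / 2; b₁ / 2, b₂ / 2, 0]

/-- Its vorticity `ω = (−g′, f′, 0) = (−b₂, b₁, 0)`. [folklore] -/
def shearVorticity (b₁ b₂ : ℝ) : Fin 3 → ℝ := ![-b₂, b₁, 0]

/-- **Unidirectional shears are structural zeros of the K1-Q2 kill-all search (zeroth order of
N11(f))**: the shear strain is symmetric and trace-free with `det = 0` (so `λ₂ = 0` by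
`middle_eq_zero_of_det_eq_zero`) and the stretching `ωᵀSω` vanishes identically. [folklore] -/
theorem shear_structural_zero (b₁ b₂ : ℝ) :
    (shearStrain b₁ b₂).IsSymm ∧ (shearStrain b₁ b₂).trace = 0 ∧ (shearStrain b₁ b₂).det = 0 ∧
      dotProduct (shearVorticity b₁ b₂) ((shearStrain b₁ b₂).mulVec (shearVorticity b₁ b₂)) = 0 := by
  refine ⟨?_, ?_, ?_, ?_⟩
  · ext i j
    fin_cases i <;> fin_cases j <;> simp [shearStrain]
  · simp [Matrix.trace, Matrix.diag, Fin.sum_univ_three, shearStrain]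
  · norm_num [shearStrain, Matrix.det_fin_three, Matrix.cons_val_zero, Matrix.cons_val_one,
      Matrix.cons_val_two, Matrix.head_cons, Matrix.tail_cons]
  · simp [shearStrain, shearVorticity, Matrix.mulVec, dotProduct, Fin.sum_univ_three]

/-- Hence `λ₂ = 0` for every unidirectional shear strain. [folklore] -/
theorem middle_shearStrain_eq_zero (b₁ b₂ : ℝ) :
    (Matrix.isHermitian_iff_isSymm.mpr (shear_structural_zero b₁ b₂).1).eigenvalues₀
      (Fin.cast (Fintype.card_fin 3).symm 1) = 0 :=
  middle_eq_zero_of_det_eq_zero (Fintype.card_fin 3) _ (shear_structural_zero b₁ b₂).1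
    (shear_structural_zero b₁ b₂).2.1 (shear_structural_zero b₁ b₂).2.2.1


end MiddleEigen

end Summit.NavierStokesRegularity.FunctionalMining

end
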